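import Literature.NumberTheory.EllipticCurves.Disegni2017.CyclotomicLineRankinSelberg
import Literature.NumberTheory.EllipticCurves.Disegni2017.TwistedBranchLeadingTerm
import HarnessLib

/-!
# Disegni 2017 Thm. A (on the cyclotomic line) ∧ Thm. B ÷ YZZ (1.1.3) (at `𝟙_K`) for Disegni's height
# datum on `E(K)`, CONJOINED with Delbourgo 2002 Thm. (B) for its restriction to `E(ℚ)` — ONE named fact

Topic `Literature/NumberTheory/EllipticCurves`, cluster `Disegni2017` (namespace = path). ONE named fact
(`def … : Prop`, cited, nothing proved; net literature debt +1) and its projections. Filed by the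
literature seat of the cell `bsd-addord` (FULL-BSD rank-`≤ 1` programme, row B6 = O7-ord) at the request
of the prover seat `bsd-addord-gz` (HOME `run/shared/lean/pub/bsd-addord/`, STATUS 2026-08-25 l.384
«lit: file (B)»; typing sheet `lit/HFACT-KERNEL-INPUTS.md` §4 (B)). Its Disegni-side conjunct is the
PREDICATE `CycLineGrossZagierClauses` of `CyclotomicLineRankinSelberg.lean` (automorphic frame: complex
Rankin–Selberg values `rankinSelbergEulerProductHecke`, `ι : ℚ̄_p ≅ ℂ`, Gauss sums; every clause located
there), its Delbourgo-side conjuncts are `Delbourgo2002.LeadingTermClauses` (J. Number Theory 95 (2002)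
Thm. (B) p. 40, `ℓ_p` evaluated) and — on the (G)-ordinary rows at `p ≥ 5`, the hypotheses of the tree's
`Delbourgo2002.mainTheorem_intrinsic` — `Delbourgo2002.LeadingTermClausesIntrinsic` (the same theorem
with `ℓ_p` read as the universal-norm index, p. 67 (iv) / p. 69), for the SAME datum restricted to `E(ℚ)`
with factor `1`; the identification of the two data is the cell referee's condition GZ-H, carried
verbatim from `TwistedBranchLeadingTerm.lean` (Disegni 2017 Rem. 1.3.2 + §4.1 (4.1.7)–(4.1.8) + Delbourgo
2002 p. 39).

PURPOSE (why this fact exists next to `delbourgoDatum_rankOne_leadingTerms` = "hFact" and its (B♮) twin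
`delbourgoDatumIntrinsic_rankOne_leadingTerms`). hFact's Gross–Zagier conjunct
`TwistedBranchGrossZagierAt` is the cell memo's THEOREM 1 (PROOF-gz v1.3, referee PASS with GZ-H): a
statement on the Mazur–Tate–Teitelbaum `ω^{(p−1)/2}`-branch of the twist `V`, obtained from Disegni's
Rankin–Selberg function by Artin formalism, Birch's formula and a uniqueness principle. From THIS fact +
`rankinSelbergEulerProductHecke_baseChangeDirichlet_eq` (Artin formalism, named fact) + the tree's
theorems (`twisted_LValue_eq_holds`, `hasSum_coeff_padicLFunctionBranch_mul_pow_of_isNewformOf`,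
`MemIwasawaRat` uniqueness over `ℂ_p`, Pal 2012, Gross–Zagier–Kolyvagin, Waldspurger/BFH–MM for the
choice of `K`) the prover seat derives hFact and its twin as THEOREMS
(`delbourgoDatum_rankOne_leadingTerms_of_disegniLine`, Summits side), so that the only reading left in
the rank-one end states of the additive (G)-ordinary / (M) rows is the present verbatim-shaped one.

## The statement (all hypotheses; `E = W`)

For: `W/ℚ` globally minimal elliptic WITHOUT CM; `p` an ODD prime of ADDITIVE reduction
(`Addv W p`); `ord_{s=1} L(E,s) = 1` (as in hFact — print does not need it; kept so that this fact is
exactly hFact's input); the printed hypotheses of Delbourgo 2002 Thm. (B) at `(W,p)`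
(`Delbourgo2002PrintedHypotheses`, the disjunction (G) `p ≥ 5` ∨ (M) ∨ `p = 3`); a globally minimal
`V` with `C • V^{(p*)} = W`, `p* = (−1)^{(p−1)/2} p` (`pStar`), which is good ORDINARY at `p` with
`α = unitRoot V p` or MULTIPLICATIVE at `p` with `α = a_p(V) = ±1` (`(V.LFunction p : ℤ)`, the currency
of `TwistedBranchGrossZagierAt`'s multiplicative clause) — so `σ_{E,p}` is nearly `p`-ordinary with unit
character `α₀·ε_p`, `α₀(p) = α`, Disegni Def. 1.2.2 + fn. (9); `fE` the newform of `E`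
(`IsNewformOf W fE`); `K` an imaginary quadratic field (`IsImaginaryQuadratic K`; Galois over `ℚ`) in
which EVERY prime dividing the conductor `N_E = W.conductorNorm ℤ` splits
(`SatisfiesHeegnerHypothesis (W.conductorNorm ℤ) K`; in particular `p` splits, and `ε(E/K) = −1`);
`ι : ℚ̄_p ≅ ℂ` any field isomorphism. Conclusion: there are a `ℚ`-datum `Dh : PAdicHeightData W p`
(print: Delbourgo's `⟨,⟩_{p,ℚ} = ½⟨,⟩^{Sch}_{p,ℚ(√p*)}`, p. 39) and a `K`-datum
`DhK : PAdicHeightDataK W p K` (print: Disegni's pairing (1.3.2) at `χ = 𝟙_K` composed with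
`ℓ = log_p ∘ χ_cyc`, absolutely normalised by (4.1.7)) with
* `DhK.RestrictsToWith Dh 1` — (4.1.7)–(4.1.8): the potentially semistable pairing is DEFINED by base
  change and division by the degree, so its restriction to `E(ℚ)` is the `ℚ`-pairing with factor `1`;
* `Delbourgo2002.LeadingTermClauses W p Dh` — Delbourgo 2002 Thm. (B) for `⟨,⟩_{p,ℚ}` (PRINTED);
* `5 ≤ p →` (G)-ordinary in the printed global form `→ Delbourgo2002.LeadingTermClausesIntrinsic W p Dh`
  — the same theorem read intrinsically (hypotheses of `Delbourgo2002.mainTheorem_intrinsic` verbatim;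
  cell referee ruling (α′) ADMISSIBLE); the (M) and `p = 3` rows get no intrinsic clause (none is in the
  tree's transcriptions there);
* `CycLineGrossZagierClauses W K ι fE α DhK` — Disegni 2017 Thm. A restricted to the cyclotomic line
  through `𝟙_K` (as corrected: `∈ 𝒪(𝒴′)^b`) ∧ Thm. B (constant `c_E` as corrected, `d_F` converted by the
  errata's fn. (11)) ÷ (1.1.3) (Yuan–Zhang–Zhang, absolute heights §7.1.1) at `χ = 𝟙_K`, for ONE
  archimedean constant `Car > 0`, ONE line function `G`, ONE pair of points and `q ∈ ℚ^×` (PRINTED;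
  shapes and locators in `CyclotomicLineRankinSelberg.lean`).

## Why ONE conjoined fact (vacuity discipline; as in hFact §«Why a CONJOINED fact»)

`PAdicHeightData` / `PAdicHeightDataK` are ABSTRACT pairings: `LeadingTermClauses` pins `Reg_p(Dh)` up to
`ℤ_p^×`, `PAdicRatioClause` pins one value of `DhK` exactly GIVEN `G`; a bare "`∃ DhK, PAdicRatioClause`"
would be satisfiable by rescaling. Print asserts all clauses OF ONE OBJECT: Delbourgo's `⟨,⟩_{p,ℚ}`
(p. 39: "`⟨,⟩_{p,ℚ} := [K:ℚ]⁻¹⟨,⟩^{Sch}_{p,K}`", `K = ℚ(√p*)`) IS Nekovář's canonical height of `V_pE`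
with its potentially-ordinary splitting restricted to `E(ℚ)` (Disegni §4.1 (4.1.7) "`ℓ_w := [F′:F]⁻¹
ℓ_v ∘ N_{F′_w/F_v}`", (4.1.8) "This allows to define the pairing in the potentially semistable case as
well"), and for NON-EXCEPTIONAL `χ` Disegni's pairing is that canonical one (Rem. 1.3.2) — `𝟙_K` is not
exceptional here since `Z_w(𝟙_w) = α⁻¹τ(ε_p) ≠ 0` (`zCircOne_ne_zero`). REFEREE CONDITION GZ-H (binding
locator sentence, verbatim as in hFact): the identification of Disegni's canonical height with
Schneider's is the (n-exc)-CONDITIONAL printed sentence Disegni 2017 Rem. 1.3.2 (arXiv v3 p. 9 = TeX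
p0007 L48) together with Disegni, Invent. Math. 230 (2022) Thm. B context (TeX p0007 L55–62: under
(n-exc) `h_V` coincides with all other `p`-adic height pairings), with (n-exc) DISCHARGED because `ε_p`
is ramified (also for split multiplicative `V`); it is NOT Delbourgo 2002 p. 62's unconditional claim,
and Nekovář 1993 §7.14 (the sentence's source) is not held on the hub (acq-10827), so the verification
trail is the printed statements of Disegni 2017/2022.

## READING r2 — the receptacle of Theorem A on the line (cell referee finding F-713-D, routed to this fact)

Compos. Math. 153 (arXiv v3 PDF 8, the paragraph after Theorem A) prints: «In fact, we only construct
`L_{p,α}(σ_E)` as a bounded section of `𝒪_{𝒴′×Ψ_p}(ω_p⁻¹χ_{F,univ,p})(D)`, where `D` is a divisor on `𝒴′`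
supported away from `𝒴` … This is sufficient for our purposes and to determine `L_{p,α}(σ_E)` uniquely.
One can then deduce that it is possible to take `D = 0` by comparing our `p`-adic `L`-function to some
other construction where this difficulty does not arise.» The cyclotomic LINE `{θ ∘ N_{K/ℚ}}` is NOT
contained in `𝒴` (its points restrict to `θ²` on `𝔸^×`, not to `ω⁻¹ = 𝟙`), so «supported away from `𝒴`»
does not by itself exclude poles on the line. The STATEMENT typed here — `IsLineFunction G`: BOUNDED
coefficients on the line (inside `CycLineInterpolation`) — follows the author's published ERRATUM, which
supersedes the divisor caveat: Disegni, J. Inst. Math. Jussieu 22 (2023), App. B «Errata to [I]»,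
Theorem A: «It should be `L_{p,α}(σ_E) ∈ 𝒪(𝒴′)^b` (with the interpolation property being correct for the
choice of additive character `ψ_p` as in Theorem A). For a correct discussion of the ring of rationality
of `L_{p,α}(σ_E)`, within the context of a generalised construction, see [Dis/b, Corollary 4.5.4]»
(wording per the published App. B; [Dis/b] = Disegni, *The universal `p`-adic Gross–Zagier formula*,
Invent. Math. 230 (2022) 509–649, bib `Disegni2022`). READING r2 := «bounded on all of `𝒴′`, hence on
the line» is the corrected printed statement, not the v3 fine print. FALLBACK F-D (not adopted; a
one-line weakening of `IsLineFunction` should a referee prefer the v3 form): «there is a nonzero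
polynomial `g ∈ ℚ_p[T]` with `g(0) ≠ 0` and `g·G` bounded» — the consumer's uniqueness argument
(PROOF-gz §3.4, `MemIwasawaRat`/`ℂ_p` factorisation) runs unchanged under it. Audit trail: typing sheet
`lit/HFACT-KERNEL-INPUTS.md` §2 P2 (caveat quoted in full, r2 declared), `REF-g18-checks.md` §3 (c).

## `K` and `ι` are BINDERS (not existentially quantified inside)

Theorems A/B hold for EVERY imaginary quadratic `K` with the Heegner hypothesis for `N_E` (and `p`
split, which that hypothesis contains since `p ∣ N_E`) and every `ι`. The EXISTENCE of such a `K` with,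
moreover, `L(E^{(d_K)}, 1) ≠ 0` — what the prover's kernel derivation divides by — is a different
printed theorem ALREADY in the tree as a named fact, not restated here:
`waldspurger_exists_heegnerField_twist_ne_zero` (`NonvanishingTwists.lean`; root number `−1`, which
`ord_{s=1} L(E,s) = 1` gives) resp. Bump–Friedberg–Hoffstein / Murty–Murty; `IsGalois ℚ K` for a
quadratic `K` is `Literature.FieldTheory.Galois.isGalois_of_finrank_eq_two`. Heegner is stated at the
level `W.conductorNorm ℤ` (verbatim the currency of those facts); the level `N` of `fE` is free
(`IsNewformOf.level_eq_conductorNorm` identifies it, consumer-side if needed).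

## What is NOT here

No proof (`_holds`: size L — it is Disegni's 90-page theorem plus YZZ); no Shimura-curve object; no
`p` inert or ramified in `K` ([II]/[III]); no defect `3, 4, 6` (unit character `α₀·ε` only:
`-- TODO(general form)`); nothing at `p = 2`; no claim on the (M)/`p = 3` rows beyond the evaluated
`LeadingTermClauses`; no choice of `K`; NOTHING about the Mazur–Tate–Teitelbaum branches (that is the
consumer's theorem). Nothing is asserted; users take `(h : delbourgoDatum_cycLineGrossZagier)`.

## References

* [Disegni2017] D. Disegni, *The p-adic Gross–Zagier formula on Shimura curves*, Compos. Math. 153 (2017)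
  1987–2074 = arXiv:1510.02114v3: Thm. A (PDF 7–8), Thm. B (PDF 9), (1.1.3)–(1.1.4) (PDF 4–5),
  Def. 1.2.2 + fn. (9) (PDF 5, 8), Rem. 1.3.2 / Def. 1.3.3 (PDF 9), §4.1 (4.1.5)–(4.1.8) (PDF 39),
  Lemma 10.2.1–10.2.2 (PDF 68), Lemma A.1.1 (PDF 70).
* [Disegni2023ShimuraII] D. Disegni, J. Inst. Math. Jussieu 22 (2023), App. B «Errata to [I]»
  (arXiv:1907.13040v4 PDF 31–32): Thm. A/B corrections and footnote (11).
* [Disegni2022] D. Disegni, *The universal p-adic Gross–Zagier formula*, Invent. Math. 230 (2022)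
  509–649 (= [Dis/b] of the errata: Cor. 4.5.4, ring of rationality / boundedness of `L_{p,α}(σ_E)`).
* [YuanZhangZhang2013] X. Yuan, S.-W. Zhang, W. Zhang, Ann. Math. Stud. 184, Thm. 1.2, §7.1.1.
* [Delbourgo2002] D. Delbourgo, J. Number Theory 95 (2002): Hypothesis p. 39, `⟨,⟩_{p,ℚ}` p. 39,
  Thm. (A)/(B) p. 40, p. 67 (iv), p. 69.
* [Nekovar1993] J. Nekovář, *On p-adic height pairings*, Sém. Théor. Nombres Paris 1990–91 (1993) §7
  (not held; acq-10827).
* Cell: `lit/HFACT-KERNEL-INPUTS.md` §4 (B), `lit/R188-6-PACKET-hFact.md`, `frozen/PROOF-gz-v1.3-….md` §3,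
  `REF-gz.md` (GZ-H), STATUS 2026-08-25 l.366 (interface), l.384 (this request).
-/

noncomputable section

open scoped Classical MatrixGroups ModularForm NumberField

open CongruenceSubgroup WeierstrassCurve NumberField IsDedekindDomain
  Literature.NumberTheory.EllipticCurves Literature.NumberTheory.EllipticCurves.ModularForms
  Literature.NumberTheory.EllipticCurves.Rank1Residual

namespace Literature.NumberTheory.EllipticCurves.Disegni2017

/-! ### §1 The named fact -/

/-- **Delbourgo's datum is the restriction of Disegni's, and the printed theorems hold for it**:
Disegni 2017 Thm. A on the cyclotomic line through `𝟙_K` ∧ Thm. B ÷ YZZ (1.1.3) at `𝟙_K` for Disegni's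
height datum `DhK` on `E(K)` (`CycLineGrossZagierClauses`); Delbourgo 2002 Thm. (B) for its restriction
`Dh` to `E(ℚ)` (`Delbourgo2002.LeadingTermClauses`, and — for `p ≥ 5` under the (G)-ordinary hypothesis
in its printed global form, i.e. the hypotheses of `Delbourgo2002.mainTheorem_intrinsic` — also
`Delbourgo2002.LeadingTermClausesIntrinsic`); `DhK.RestrictsToWith Dh 1` = the absolute normalisation
(4.1.7)–(4.1.8). Setting: `W/ℚ` globally minimal WITHOUT CM, `p` odd, ADDITIVE at `p`,
`ord_{s=1}L(E,s) = 1`, `Delbourgo2002PrintedHypotheses W p`; `C • V^{(p*)} = W` for a globally minimal `V`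
good ORDINARY (`α = unitRoot V p`) or MULTIPLICATIVE (`α = a_p(V)`) at `p`; `fE` the newform of `W`; `K`
imaginary quadratic, Galois over `ℚ`, with every prime dividing `N_E = W.conductorNorm ℤ` split in `K`
(Heegner hypothesis; so `p` splits, `ε(E/K) = −1`); `ι : ℚ̄_p ≅ ℂ`. REFEREE CONDITION GZ-H exactly as in
`delbourgoDatum_rankOne_leadingTerms` (module docstring §«Why ONE conjoined fact»: Nekovář = Schneider at
the non-exceptional `𝟙_K`, Disegni 2017 Rem. 1.3.2 with (n-exc) discharged by `Z_w(𝟙_w) ≠ 0`; Nekovář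
1993 §7.14 not held, acq-10827). `K`, `ι` are binders: the existence of a Heegner `K` with
`L(E^{(d_K)},1) ≠ 0` is `waldspurger_exists_heegnerField_twist_ne_zero` (not restated). READING r2
(module docstring; referee finding F-713-D): «`G` bounded on the line» (`IsLineFunction`) is Theorem A AS
CORRECTED in the errata («`L_{p,α}(σ_E) ∈ 𝒪(𝒴′)^b`», pointer [Dis/b, Cor. 4.5.4] = Disegni 2022), which
supersedes v3's «bounded section of `𝒪(…)(D)`, `D` supported away from `𝒴`» (the line is not inside `𝒴`);
fallback F-D («`∃ g ≠ 0` polynomial, `g(0) ≠ 0`, `g·G` bounded») not adopted. Nothing asserted;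
users take `(h : delbourgoDatum_cycLineGrossZagier)`; no `_holds` (size L).
[cite: Disegni2017, Thm. A (§1.2, arXiv v3 PDF 7–8), Thm. B (§1.3.2, PDF 9), (1.1.3)–(1.1.4) (PDF 4–5), Def. 1.2.2 + fn. (9), Rem. 1.3.2, §4.1 (4.1.7)–(4.1.8) (PDF 39)]
[cite: Disegni2023ShimuraII, App. B Thm. A («∈ 𝒪(𝒴′)^b», pointer to [Dis/b, Cor. 4.5.4]), Thm. B and fn. (11) (arXiv v4 PDF 31)]
[cite: Disegni2022, Cor. 4.5.4 (the errata's pointer for the ring of rationality / boundedness)]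
[cite: YuanZhangZhang2013, Thm. 1.2, §7.1.1] [cite: Delbourgo2002, p. 39 (Hypothesis; ⟨,⟩_{p,ℚ}), Theorem (B) (p. 40), p. 67 (iv), p. 69] -/
def delbourgoDatum_cycLineGrossZagier : Prop :=
  ∀ (W : WeierstrassCurve ℚ) [W.IsElliptic] [W.IsGloballyMinimal] (p : ℕ) [Fact p.Prime]
    (K : Type) [Field K] [NumberField K] [IsGalois ℚ K] (ι : PadicAlgCl p ≃+* ℂ)
    (V : WeierstrassCurve ℚ) [V.IsElliptic] [V.IsGloballyMinimal] (C : VariableChange ℚ)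
    {N : ℕ} [NeZero N] (fE : CuspForm (Gamma0 N) 2) (α : ℚ_[p]),
    p ≠ 2 → ¬ W.HasCM → Addv W p → W.analyticRank = 1 → Delbourgo2002PrintedHypotheses W p →
    C • V.quadraticTwist (pStar p : ℚ) = W →
    ((Good V p ∧ IsOrdinaryAt V p ∧ α = (unitRoot V p : ℚ_[p])) ∨
      (Mult V p ∧ α = ((V.LFunction p : ℤ) : ℚ_[p]))) →
    IsNewformOf W fE →
    IsImaginaryQuadratic K → SatisfiesHeegnerHypothesis (W.conductorNorm ℤ) K →
    ∃ (Dh : PAdicHeightData W p) (DhK : PAdicHeightDataK W p K),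
      DhK.RestrictsToWith Dh 1 ∧
      Delbourgo2002.LeadingTermClauses W p Dh ∧
      (5 ≤ p →
        (∃ (L : Type) (_ : Field L) (_ : NumberField L) (_ : IsCyclotomicExtension {p} ℚ L)
            (F : IntermediateField ℚ L),
            ∀ w : HeightOneSpectrum (𝓞 F), (p : 𝓞 F) ∈ w.asIdeal →
              (W.baseChange F).HasGoodReductionAt w ∧ (W.baseChange F).HasUnitRootAt w) →
        Delbourgo2002.LeadingTermClausesIntrinsic W p Dh) ∧
      CycLineGrossZagierClauses W K ι fE α DhK

/-! ### §2 Projections (bookkeeping; the two shapes the cell's end states consume) -/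

namespace delbourgoDatum_cycLineGrossZagier

/-- **The (B)-currency shape** (STATUS l.384 verbatim): `∃ Dh DhK, DhK.RestrictsToWith Dh 1 ∧
Delbourgo2002.LeadingTermClauses W p Dh ∧ CycLineGrossZagierClauses W K ι fE α DhK`.
[cite: Delbourgo2002, Theorem (B) (p. 40)] [cite: Disegni2017, Thm. A/B (arXiv v3 PDF 7–9)] -/
theorem exists_datum (h : delbourgoDatum_cycLineGrossZagier)
    {W : WeierstrassCurve ℚ} [W.IsElliptic] [W.IsGloballyMinimal] {p : ℕ} [Fact p.Prime]
    {K : Type} [Field K] [NumberField K] [IsGalois ℚ K] (ι : PadicAlgCl p ≃+* ℂ)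
    {V : WeierstrassCurve ℚ} [V.IsElliptic] [V.IsGloballyMinimal] {C : VariableChange ℚ}
    {N : ℕ} [NeZero N] {fE : CuspForm (Gamma0 N) 2} {α : ℚ_[p]}
    (hp : p ≠ 2) (hcm : ¬ W.HasCM) (hadd : Addv W p) (hr : W.analyticRank = 1)
    (hH : Delbourgo2002PrintedHypotheses W p) (hC : C • V.quadraticTwist (pStar p : ℚ) = W)
    (hα : (Good V p ∧ IsOrdinaryAt V p ∧ α = (unitRoot V p : ℚ_[p])) ∨
      (Mult V p ∧ α = ((V.LFunction p : ℤ) : ℚ_[p])))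
    (hf : IsNewformOf W fE) (hK : IsImaginaryQuadratic K)
    (hHeeg : SatisfiesHeegnerHypothesis (W.conductorNorm ℤ) K) :
    ∃ (Dh : PAdicHeightData W p) (DhK : PAdicHeightDataK W p K),
      DhK.RestrictsToWith Dh 1 ∧ Delbourgo2002.LeadingTermClauses W p Dh ∧
        CycLineGrossZagierClauses W K ι fE α DhK := by
  obtain ⟨Dh, DhK, h1, h2, -, h4⟩ := h W p K ι V C fE α hp hcm hadd hr hH hC hα hf hK hHeeg
  exact ⟨Dh, DhK, h1, h2, h4⟩

/-- **The (B♮)-currency shape** (hypotheses of `Delbourgo2002.mainTheorem_intrinsic` /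
`delbourgoDatumIntrinsic_rankOne_leadingTerms` verbatim: `p ≥ 5`, additive, (G)-ordinary in the printed
global form; `Delbourgo2002PrintedHypotheses` then holds by its first disjunct): `∃ Dh DhK,
DhK.RestrictsToWith Dh 1 ∧ Delbourgo2002.LeadingTermClausesIntrinsic W p Dh ∧
Delbourgo2002.LeadingTermClauses W p Dh ∧ CycLineGrossZagierClauses W K ι fE α DhK` — ONE datum for both
readings of Thm. (B). [cite: Delbourgo2002, Theorem (B) (p. 40), p. 67 (iv), p. 69]
[cite: Disegni2017, Thm. A/B (arXiv v3 PDF 7–9)] -/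
theorem exists_datum_intrinsic (h : delbourgoDatum_cycLineGrossZagier)
    {W : WeierstrassCurve ℚ} [W.IsElliptic] [W.IsGloballyMinimal] {p : ℕ} [Fact p.Prime]
    {K : Type} [Field K] [NumberField K] [IsGalois ℚ K] (ι : PadicAlgCl p ≃+* ℂ)
    {V : WeierstrassCurve ℚ} [V.IsElliptic] [V.IsGloballyMinimal] {C : VariableChange ℚ}
    {N : ℕ} [NeZero N] {fE : CuspForm (Gamma0 N) 2} {α : ℚ_[p]}
    (hp5 : 5 ≤ p) (hcm : ¬ W.HasCM)
    (hadd : ¬ W.HasGoodReductionAtPrime p ∧ ¬ W.HasMultiplicativeReductionAtPrime p)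
    (hG : ∃ (L : Type) (_ : Field L) (_ : NumberField L) (_ : IsCyclotomicExtension {p} ℚ L)
        (F : IntermediateField ℚ L),
        ∀ w : HeightOneSpectrum (𝓞 F), (p : 𝓞 F) ∈ w.asIdeal →
          (W.baseChange F).HasGoodReductionAt w ∧ (W.baseChange F).HasUnitRootAt w)
    (hr : W.analyticRank = 1) (hC : C • V.quadraticTwist (pStar p : ℚ) = W)
    (hα : (Good V p ∧ IsOrdinaryAt V p ∧ α = (unitRoot V p : ℚ_[p])) ∨
      (Mult V p ∧ α = ((V.LFunction p : ℤ) : ℚ_[p])))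
    (hf : IsNewformOf W fE) (hK : IsImaginaryQuadratic K)
    (hHeeg : SatisfiesHeegnerHypothesis (W.conductorNorm ℤ) K) :
    ∃ (Dh : PAdicHeightData W p) (DhK : PAdicHeightDataK W p K),
      DhK.RestrictsToWith Dh 1 ∧ Delbourgo2002.LeadingTermClausesIntrinsic W p Dh ∧
        Delbourgo2002.LeadingTermClauses W p Dh ∧ CycLineGrossZagierClauses W K ι fE α DhK := by
  have hp : p ≠ 2 := by omega
  obtain ⟨Dh, DhK, h1, h2, h3, h4⟩ :=
    h W p K ι V C fE α hp hcm hadd hr (delbourgo2002PrintedHypotheses_of_typeG hp5 hG) hC hα hf hK hHeeg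
  exact ⟨Dh, DhK, h1, h3 hp5 hG, h2, h4⟩

end delbourgoDatum_cycLineGrossZagier

end Literature.NumberTheory.EllipticCurves.Disegni2017

end
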